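import Summits.AtomisticToContinuum.Crystallization.Theorems.ChartedPlanarOrderCleanScaleP
import Summits.AtomisticToContinuum.Crystallization.Theorems.ChartedPlanarOrderStackedSiteData

/-!
# ChartedPlanarOrder — the layering dichotomy `StackedDichotomy` (critic row 445 (α))

decomp-a2c lens-3 (generation 23/24; N = `Theses.ChartedPlanarOrder.ChartedZeroExcessLayered`, PS column;
the shared input of `W_far` / `W_near` (lens-3) and `StackedRep` (lens-4)).

`StackedDichotomy aHi`: a `δ`-separated, `(1/16, 9/10, aHi)`-clean, STACKED layered set `Layered a b w` with short
periods `‖a‖, ‖b‖ ≤ 17/16` has a unit stacking normal `ν ⊥ a, b` and, for EVERY layer `m`, a pattern scale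
`a′ ∈ [9/10, aHi]` with `|‖a‖ − a′|, |‖b‖ − a′| ≤ a′/16` and EITHER
(T) TRIANGULAR in-plane lattice `| |⟪a,b⟫| − a′²/2 | ≤ 33a′²/256` with spacing `12/25·a′ ≤ H_{m+1} ≤ 101/100·a′`, OR
(S) SQUARE in-plane lattice `|⟪a,b⟫| ≤ 33a′²/256` with spacing `a′/2 ≤ H_{m+1} ≤ 9/10·a′`
(`H_{m+1} = ⟪ν, w (m+1) − w m⟫`).  `stackedDichotomy : aHi ≤ 8/7 → StackedDichotomy aHi`.

Proof (per layer, at the atom `q = w m`): `…CleanEnvironment.periods_type` (periods are a matched first-shell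
antipodally-closed pair, type T/S) → `…StackedSiteData.exists_oriented_siteData` (pattern normal `n`, spacing class
`h`, classes, in-plane sites = period combinations) → tilt `…LayerFrame.tilt_bound` + `…StackedLayerGeometry`
numerics (`cos ≥ 0.976 / 0.988`) → the up-site atom bounds `H_{m+1}` above → a layer-`(m+1)` atom within `3a′/2`
of `q` (lattice reduction) is matched to a site of class `+h`: class `0` is excluded by `eq_of_inplane`, negative
classes by sign, class `2h` by the upper bound → the lower window.
-/

open MeasureTheory Set Metric
open scoped RealInnerProductSpace
open Literature.Geometry.DiscreteGeometry
open Summit.AtomisticToContinuum.Crystallization.Theorems.ChartedPlanarOrderRigidityDoor (E3)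
open Summit.AtomisticToContinuum.Crystallization.Theorems.ChartedPlanarOrderDensityDichotomy (IsSep μS)
open Summit.AtomisticToContinuum.Crystallization.Theorems.ChartedPlanarOrderProfileSlavingLJ (IsStacked)
open Summit.AtomisticToContinuum.Crystallization.Theorems.ChartedPlanarOrderDoorLayered (Layered)
open Summit.AtomisticToContinuum.Crystallization.Theorems.ChartedPlanarOrderCleanScaleP (IsCleanP isCleanP_μS_iff cleanStackedIndependentP)
open Summit.AtomisticToContinuum.Crystallization.Theorems.ChartedPlanarOrderSepCounting (exists_unit_normal)
open Summit.AtomisticToContinuum.Crystallization.Theorems.ChartedPlanarOrderLayerFrame (tilt_bound)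
open Summit.AtomisticToContinuum.Crystallization.Theorems.ChartedPlanarOrderCleanEnvironment
open Summit.AtomisticToContinuum.Crystallization.Theorems.ChartedPlanarOrderStackedLayerGeometry
open Summit.AtomisticToContinuum.Crystallization.Theorems.ChartedPlanarOrderStackedSiteData

namespace Summit.AtomisticToContinuum.Crystallization.Theorems.ChartedPlanarOrderStackedDichotomy

/-! ## §4 The statement and the per-layer theorem -/

/-- ★★★ `StackedDichotomy aHi` — the LAYERING DICHOTOMY (critic row 445 (α)): separated + clean + stacked + short
periods ⇒ per layer a pattern scale `a′` and EITHER a triangular in-plane lattice with spacing window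
`[12/25, 101/100]·a′` OR a square one with spacing window `[1/2, 9/10]·a′`. -/
def StackedDichotomy (aHi : ℝ) : Prop :=
  ∀ δ : ℝ, 0 < δ → ∀ (a b : E3) (w : ℤ → E3), IsSep δ (Layered a b w) → IsCleanP aHi (μS (Layered a b w)) →
    IsStacked a b w → ‖a‖ ≤ 17 / 16 → ‖b‖ ≤ 17 / 16 →
    ∃ ν : E3, ‖ν‖ = 1 ∧ ⟪ν, a⟫ = 0 ∧ ⟪ν, b⟫ = 0 ∧ (∀ m : ℤ, 0 < ⟪ν, w (m + 1) - w m⟫) ∧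
    ∀ m : ℤ, ∃ a' : ℝ, 9 / 10 ≤ a' ∧ a' ≤ aHi ∧ |‖a‖ - a'| ≤ 1 / 16 * a' ∧ |‖b‖ - a'| ≤ 1 / 16 * a' ∧
      ((|(|⟪a, b⟫| - a' ^ 2 / 2)| ≤ 33 / 256 * a' ^ 2 ∧
          12 / 25 * a' ≤ ⟪ν, w (m + 1) - w m⟫ ∧ ⟪ν, w (m + 1) - w m⟫ ≤ 101 / 100 * a') ∨
       (|⟪a, b⟫| ≤ 33 / 256 * a' ^ 2 ∧
          1 / 2 * a' ≤ ⟪ν, w (m + 1) - w m⟫ ∧ ⟪ν, w (m + 1) - w m⟫ ≤ 9 / 10 * a'))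

section Layer

variable {aHi : ℝ} {a b ν : E3} {w : ℤ → E3}

/-- ★★ THE PER-LAYER WINDOW. -/
theorem layer_window (hclean : ∀ q ∈ Layered a b w, IsTwoShellGoodSet (1 / 16) (9 / 10) aHi (Layered a b w) q)
    (hν1 : ‖ν‖ = 1) (hνa : ⟪ν, a⟫ = 0) (hνb : ⟪ν, b⟫ = 0) (hνpos : ∀ m : ℤ, 0 < ⟪ν, w (m + 1) - w m⟫)
    (ha0 : a ≠ 0) (hb0 : b ≠ 0) (hab : a ≠ b) (hab' : a + b ≠ 0) (han : ‖a‖ ≤ 17 / 16) (hbn : ‖b‖ ≤ 17 / 16) (m : ℤ) :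
    ∃ a' : ℝ, 9 / 10 ≤ a' ∧ a' ≤ aHi ∧ |‖a‖ - a'| ≤ 1 / 16 * a' ∧ |‖b‖ - a'| ≤ 1 / 16 * a' ∧
      ((|(|⟪a, b⟫| - a' ^ 2 / 2)| ≤ 33 / 256 * a' ^ 2 ∧
          12 / 25 * a' ≤ ⟪ν, w (m + 1) - w m⟫ ∧ ⟪ν, w (m + 1) - w m⟫ ≤ 101 / 100 * a') ∨
       (|⟪a, b⟫| ≤ 33 / 256 * a' ^ 2 ∧
          1 / 2 * a' ≤ ⟪ν, w (m + 1) - w m⟫ ∧ ⟪ν, w (m + 1) - w m⟫ ≤ 9 / 10 * a')) := by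
  have hq : w m ∈ Layered a b w := offset_mem m
  obtain ⟨a', ha'lo, ha'hi, A, P, f, hP, hm, -, hc⟩ := hclean (w m) hq
  have ha'pos : 0 < a' := by linarith
  have hqa : w m + a ∈ Layered a b w := by simpa using add_period_mem hq 1 0
  have hqa' : w m - a ∈ Layered a b w := by simpa using sub_period_mem hq 1 0
  have hqb : w m + b ∈ Layered a b w := by simpa using add_period_mem hq 0 1
  have hqb' : w m - b ∈ Layered a b w := by simpa using sub_period_mem hq 0 1
  obtain ⟨p₁, hp₁, p₂, hp₂, hp₁1, hp₂1, hnp₁, hnp₂, hne, hne', -, -, -, -, hA1, hA2, hna, hnb, -, hAB⟩ :=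
    periods_type hP hm hc ha'lo hqa hqa' hqb hqb' ha0 hb0 hab hab' han hbn
  obtain ⟨n, h, htype, ⟨hn1, hn₁, hn₂, hall, hfirst, ⟨u, hu, hu1, hut⟩, -, hC1, hC2⟩, hc0⟩ :=
    exists_oriented_siteData hP hp₁ hp₂ hp₁1 hp₂1 hnp₁ hnp₂ hne hne' A ν
  have hc1 : ⟪ν, A n⟫ ^ 2 ≤ 1 := cos_sq_le_one hν1 hn1
  have hcle : ⟪ν, A n⟫ ≤ 1 := le_one_of_sq_le_one hc1
  have htilt : (1 - ⟪ν, A n⟫ ^ 2) * (‖a‖ ^ 2 * ‖b‖ ^ 2 - ⟪a, b⟫ ^ 2) ≤ (1 / 16 * a' * (‖a‖ + ‖b‖)) ^ 2 :=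
    tilt_bound hν1 hνa hνb (norm_map_unit hn1) (abs_inner_map_le hn1 hn₁ hA1) (abs_inner_map_le hn1 hn₂ hA2)
  have hna2 : ‖a‖ ≤ 17 / 16 * a' := by have := (abs_le.1 hna).2; linarith
  have hnb2 : ‖b‖ ≤ 17 / 16 * a' := by have := (abs_le.1 hnb).2; linarith
  -- the up-site atom and its matching
  have hfu : f u ∈ Layered a b w := (hm u hu).1
  have hue : ‖(f u - w m) - a' • A u‖ ≤ 1 / 16 * a' := by
    have := (hm u hu).2; rwa [dist_eq_norm, show f u - (w m + a' • A u) = (f u - w m) - a' • A u by abel] at this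
  obtain ⟨du, eu, hHu, hdu, heu⟩ := height_formula (B := 1) hν1 hn1 hue (by rw [hu1]; norm_num)
  rw [hut] at hHu hdu
  -- a layer-(m+1) atom near w m, matched to a site z
  have hHpos : 0 < ⟪ν, w (m + 1) - w m⟫ := hνpos m
  refine ⟨a', ha'lo, ha'hi, hna, hnb, ?_⟩
  rcases htype with ⟨hh, hκ⟩ | ⟨hh, hκ, -⟩
  · -- TRIANGULAR
    left
    have hAB' : |⟪a, b⟫ - a' ^ 2 * ⟪p₁, p₂⟫| ≤ 33 / 256 * a' ^ 2 := hAB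
    have hG := gram_lower_T ha'pos hna hnb hκ hAB'
    have hs : (1 - ⟪ν, A n⟫ ^ 2) * 24704 ≤ 1156 := by
      have := tilt_budget ha'pos hc1 htilt hG hna2 hnb2 (norm_nonneg _) (norm_nonneg _); linarith
    have hcT := cos_lower_T hc0 hs
    -- upper bound from the up-site atom
    rw [hh] at hdu hHu
    rw [sq_sqrt_six_div] at hdu
    have hUp : ⟪ν, f u - w m⟫ ≤ 101 / 100 * a' := by rw [hHu]; exact window_T_up ha'pos hcle (dev_T_first hs hdu) heu
    have hUpos : 0 < ⟪ν, f u - w m⟫ := by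
      rw [hHu]
      have := window_T_low ha'pos hcT ((dev_T_first hs hdu).trans (by norm_num)) heu; linarith
    have hHle : ⟪ν, w (m + 1) - w m⟫ ≤ 101 / 100 * a' := (next_height_le hνpos hνa hνb hfu m hUpos).trans hUp
    refine ⟨abs_abs_sub_half hκ hAB', ?_, hHle⟩
    -- lower bound: the near layer-(m+1) atom is matched to a class-h site
    have hGpos : 0 < ‖a‖ ^ 2 * ‖b‖ ^ 2 - ⟪a, b⟫ ^ 2 := lt_of_lt_of_le (by positivity) hG
    obtain ⟨y, hy, hyH, hyd⟩ := exists_next_layer_atom (w := w) hν1 hνa hνb hGpos m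
    have hyq : y ≠ w m := by
      intro h0; rw [h0, sub_self, inner_zero_right] at hyH; exact hHpos.ne hyH
    have hdist : dist y (w m) ≤ 3 / 2 * a' := by
      rw [dist_eq_norm]
      refine (abs_le_of_sq_le_sq' (reach_budget (by positivity) (by linarith) hHpos.le hHle hyd) (by positivity)).2
    obtain ⟨z, hz, -, hze⟩ := exists_match hm hc hy hyq hdist
    obtain ⟨d, e, hHy, hd, he⟩ := height_formula (B := 2) hν1 hn1 hze (norm_sq_le_two hP hz)
    rw [hyH] at hHy
    rcases hfirst z hz (Or.inr hh) with hk | hk | hk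
    · -- class 0: excluded
      exfalso
      obtain ⟨i, j, hi, hj, hzij⟩ := hC1 z hz hk
      have hyeq := eq_of_inplane hclean hb0 hbn hq ha'lo hA1 hA2 hnb hy hze hi hj hzij
      have h0 : ⟪ν, y - w m⟫ = 0 := by
        rw [hyeq, add_sub_cancel_left]; exact inner_period_combo hνa hνb _ _
      rw [hyH] at h0; exact hHpos.ne' h0
    · -- class +h
      rw [hk, hh] at hHy hd
      rw [sq_sqrt_six_div] at hd
      rw [hHy]; exact window_T_low ha'pos hcT (dev_T_any hs hd) he
    · -- class −h: negative height
      exfalso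
      rw [hk, hh] at hHy hd
      rw [neg_sq, sq_sqrt_six_div] at hd
      have := window_T_neg ha'pos hcT (dev_T_any hs hd) he
      linarith
  · -- SQUARE
    right
    have hAB' : |⟪a, b⟫ - a' ^ 2 * 0| ≤ 33 / 256 * a' ^ 2 := by rw [← hκ]; exact hAB
    have hG := gram_lower_S ha'pos hna hnb hAB'
    have hs : (1 - ⟪ν, A n⟫ ^ 2) * 49536 ≤ 1156 := by
      have := tilt_budget ha'pos hc1 htilt hG hna2 hnb2 (norm_nonneg _) (norm_nonneg _); linarith
    have hcS := cos_lower_S hc0 hs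
    rw [hh] at hdu hHu
    rw [sq_sqrt_two_div] at hdu
    have hUp : ⟪ν, f u - w m⟫ ≤ 9 / 10 * a' := by rw [hHu]; exact window_S_up ha'pos hcle (dev_S_first hs hdu) heu
    have hUpos : 0 < ⟪ν, f u - w m⟫ := by
      rw [hHu]; have := window_S_low ha'pos hcS (dev_S_first hs hdu) heu; linarith
    have hHle : ⟪ν, w (m + 1) - w m⟫ ≤ 9 / 10 * a' := (next_height_le hνpos hνa hνb hfu m hUpos).trans hUp
    refine ⟨by simpa using hAB', ?_, hHle⟩
    have hGpos : 0 < ‖a‖ ^ 2 * ‖b‖ ^ 2 - ⟪a, b⟫ ^ 2 := lt_of_lt_of_le (by positivity) hG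
    obtain ⟨y, hy, hyH, hyd⟩ := exists_next_layer_atom (w := w) hν1 hνa hνb hGpos m
    have hyq : y ≠ w m := by
      intro h0; rw [h0, sub_self, inner_zero_right] at hyH; exact hHpos.ne hyH
    have hdist : dist y (w m) ≤ 3 / 2 * a' := by
      rw [dist_eq_norm]
      refine (abs_le_of_sq_le_sq' (reach_budget (by positivity) (by linarith) hHpos.le (hHle.trans (by linarith)) hyd)
        (by positivity)).2
    obtain ⟨z, hz, -, hze⟩ := exists_match hm hc hy hyq hdist
    have hh0 : 0 < h := by rw [hh]; positivity
    rcases hall z hz with hk | hk | hk | hk | hk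
    · exfalso
      obtain ⟨i, j, hi, hj, hzij⟩ := hC1 z hz hk
      have hyeq := eq_of_inplane hclean hb0 hbn hq ha'lo hA1 hA2 hnb hy hze hi hj hzij
      have h0 : ⟪ν, y - w m⟫ = 0 := by
        rw [hyeq, add_sub_cancel_left]; exact inner_period_combo hνa hνb _ _
      rw [hyH] at h0; exact hHpos.ne' h0
    · -- class +h: first shell by (C2)
      have hz1 : ‖z‖ = 1 := by
        by_contra hz1
        rcases hC2 z hz hh hz1 with h0 | h0 | h0 <;> rw [hk] at h0 <;> linarith
      obtain ⟨d, e, hHy, hd, he⟩ := height_formula (B := 1) hν1 hn1 hze (by rw [hz1]; norm_num)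
      rw [hyH, hk, hh] at hHy; rw [hk, hh, sq_sqrt_two_div] at hd
      rw [hHy]; exact window_S_low ha'pos hcS (dev_S_first hs hd) he
    · exfalso
      have hz1 : ‖z‖ = 1 := by
        by_contra hz1
        rcases hC2 z hz hh hz1 with h0 | h0 | h0 <;> rw [hk] at h0 <;> linarith
      obtain ⟨d, e, hHy, hd, he⟩ := height_formula (B := 1) hν1 hn1 hze (by rw [hz1]; norm_num)
      rw [hyH, hk, hh] at hHy; rw [hk, hh, neg_sq, sq_sqrt_two_div] at hd
      have := window_S_neg ha'pos hcS (dev_S_first hs hd) he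
      linarith
    · exfalso
      obtain ⟨d, e, hHy, hd, he⟩ := height_formula (B := 2) hν1 hn1 hze (norm_sq_le_two hP hz)
      rw [hyH, hk, hh] at hHy; rw [hk, hh, sq_two_mul_sqrt_two_div] at hd
      have := window_S_two ha'pos hcS (dev_zero hd) he
      linarith
    · exfalso
      obtain ⟨d, e, hHy, hd, he⟩ := height_formula (B := 2) hν1 hn1 hze (norm_sq_le_two hP hz)
      rw [hyH, hk, hh] at hHy; rw [hk, hh, neg_sq, sq_two_mul_sqrt_two_div] at hd
      have := window_S_negtwo ha'pos hcS (dev_zero hd) he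
      linarith

end Layer

/-! ## §5 The theorem -/

/-- ★★★ the layering dichotomy holds up to the pattern-scale ceiling `8/7` (in particular at `103/100` and `17/16`). -/
theorem stackedDichotomy {aHi : ℝ} (haHi : aHi ≤ 8 / 7) : StackedDichotomy aHi := by
  intro δ hδ a b w hsep hclean hst han hbn
  have hind := cleanStackedIndependentP haHi δ hδ a b w hsep hclean hst
  have hcl := (isCleanP_μS_iff (Layered a b w)).1 hclean
  obtain ⟨ν, hν1, hνa, hνb, hνpos⟩ := exists_unit_normal hst
  have ha0 : a ≠ 0 := by
    intro h; have := (hind.eq_zero_of_pair (s := 1) (t := 0) (by simp [h])).1; norm_num at this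
  have hb0 : b ≠ 0 := by
    intro h; have := (hind.eq_zero_of_pair (s := 0) (t := 1) (by simp [h])).2; norm_num at this
  have hab : a ≠ b := by
    intro h; have := (hind.eq_zero_of_pair (s := 1) (t := -1) (by simp [h])).1; norm_num at this
  have hab' : a + b ≠ 0 := by
    intro h; have := (hind.eq_zero_of_pair (s := 1) (t := 1) (by simpa using h)).1; norm_num at this
  exact ⟨ν, hν1, hνa, hνb, hνpos, fun m => layer_window hcl hν1 hνa hνb hνpos ha0 hb0 hab hab' han hbn m⟩

end Summit.AtomisticToContinuum.Crystallization.Theorems.ChartedPlanarOrderStackedDichotomy
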